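import Literature.AlgebraicGeometry.Motives.AbelianVarietyRosatiDualDescent
import Literature.AlgebraicGeometry.ComplexMultiplication.RosatiInvolutionOverNumberField
import HarnessLib

/-!
# A Rosati-stable `ℚ`-subalgebra of `End⁰(A)` carries a positive anti-involution; Rosati stability from LEVEL adjoints
# (Mumford §20 (3), §21 Thm. 1; Lange 2023 §2.4.1 Lemma 2.4.1, Prop. 2.4.2, Thm. 2.4.9)

Layer `Literature/AlgebraicGeometry/Motives`, namespace `Literature.AlgebraicGeometry.Motives.AbelianVariety`.
THEOREMS ONLY: no definition, no instance, no named fact, no `sorry` (net Literature debt 0).  Sequel of ★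
`Motives/AbelianVarietyRosatiLevelWeilPairing` (the Rosati dual of an endomorphism of a COMPLEX abelian variety exists and is
read on the level Weil pairings; positivity of the Rosati trace form) and ★ `Motives/AbelianVarietyRosatiDualDescent` §1
(uniqueness of the level adjoint).  NO Galois action, no descent, no countability: everything is over `ℂ`.

THE PRINT.  D. Mumford, *Abelian Varieties* (1970), §20 p. 186 (3) «`e_n(f(x), ŷ) = e_n(x, f̂(ŷ))`», §21 Thm. 1
(p. 192; positivity of the Rosati involution).  H. Lange, *Abelian Varieties over the Complex Numbers* (2023), §2.4.1:
Lemma 2.4.1 (the Rosati involution is an anti-involution of `End_ℚ(X)`), Prop. 2.4.2 (a) (it is the adjoint for the Riemann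
form), Thm. 2.4.9 (`(f, g) ↦ Tr_r(f′g)` is positive definite) — so every sub-`ℚ`-algebra of `End_ℚ(X)` STABLE under the
Rosati involution inherits a positive anti-involution.  Y. Liu, *Fourier–Jacobi cycles and arithmetic relative trace
formula* (2021), App. D p. 133 (around (D.3)): the Hecke algebra acts on the Albanese variety `A_K` of the Shimura curve
through a homomorphism of `ℚ`-algebras `C_c^∞(K\G(𝔸^∞)/K, ℚ) → End(A_K)_ℚ`; that its image is stable under the Rosati
involution of the canonical polarisation (the adjoint of `[KgK]` is a Hecke operator) is the cell's road (P), NOT printed there.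

WHAT IS PROVED (for a complex abelian variety `A` with a uniformisation `φ : X = V/Φ(ℤ^ι) → A(ℂ)` — `hφ`, `hadd` — and a
Riemann form `η` with rational Gram matrix `G`, e.g. the Néron–Severi form of an ample divisor `Θ`; `ρ(y)` denotes the
rational representation `endAlgebraEquivOfAnalytification hφ hadd y ∈ End_ℚ(X) ⊆ M_ι(ℚ)` of `y ∈ End⁰(A)`):

* §1 **`endToEndAlgRat_eq_smul_rosati_of_forall_weilPairingLevel`** — LEVEL ADJOINT ⇒ ROSATI DUAL: if `x, x† ∈ End(A)`,
  `d ∈ ℕ` satisfy `ē_N^Θ((d·x) P, Q) = ē_N^Θ(P, x† Q)` for all `N` and all `P, Q ∈ A[N](ℂ)` (`Θ` AMPLE), then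
  `ρ_r(x†) = d · rosati G ρ_r(x)` (existence ★ `exists_rosatiDual_weilPairingLevel` + uniqueness ★
  `eq_of_forall_weilPairingLevel_map_eq`);
* §2 **`exists_isPositiveAntiInvolution_subalgebra_of_forall_exists_rosati`** — a `ℚ`-subalgebra `H ⊆ End⁰(A)` such that
  `rosati G ρ(x) ∈ ρ(H)` for every `x ∈ H` carries a `ℚ`-linear `τ : H → H` with `ρ(τ x) = rosati G ρ(x)`, which is a
  POSITIVE ANTI-INVOLUTION of `H` (`Tr_{H/ℚ}(L_{τ(x)x}) > 0` for `x ≠ 0`: ★ `leftMulTrace_pos_of_adjoint_repr` with the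
  injective representation `H ↪ End⁰(A) ≃ End_ℚ(X) ⊆ M_ι(ℚ)` and the positive definite `ᵗJ·G_ℝ`);
  `forall_exists_rosati_adjoin_of_generators` — it suffices to test the GENERATORS of `H = ℚ[S]`;
* §3 **`exists_isPositiveAntiInvolution_adjoin_of_levelAdjoint`** — §1 + §2: if every `s ∈ S ⊆ End(A)` has a level
  adjoint `s†` (for an ample `Θ`) with `1 ⊗ s† ∈ ℚ[S]`, then `ℚ[S] ⊆ End⁰(A)` carries a positive anti-involution `τ`
  with `ρ(τ x) = rosati G ρ(x)`; `coe_apply_eq_smul_of_levelAdjoint` — `τ (1 ⊗ s) = d⁻¹ · (1 ⊗ s†)` on such generators.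

USE (cell `hodgecm-mathlib`, D-0151, crux `HLiu418` = stmt-HodgeConjecture-24832, d6 card S2′, road (P), socket `SocketRosH`
«the Hecke image carries a positive anti-involution» — A-plan2 (g12) 2026-08-30T03:53:02Z): the level adjoints of the Hecke
generators come from the norm/pull-back adjointness of Galois covers of curves (`Motives/JacobianGaloisCoverNormAdjoint`,
★ `Motives/JacobianGaloisCoverNorm`) and the push–pull presentation of `[KgK]` (★ `Liu2021/AppendixC/HeckeEndomorphismPushPull`).
The file moves no book (HC_CM is proved only modulo the 7 printed citations until rung 0 closes).

## References
* [MumfordAV1970] D. Mumford, *Abelian Varieties* (1970), §20 (p. 186, property (3) of `e_n`; p. 189), §21 Thm. 1.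
* [Lange2023AbelianVarietiesComplex] H. Lange, *Abelian Varieties over the Complex Numbers* (2023), §2.4.1 Lemma 2.4.1,
  Prop. 2.4.2, Thm. 2.4.9 (pp. 113–117).
* [Liu2021] Y. Liu, *Fourier–Jacobi cycles and arithmetic relative trace formula*, Camb. J. Math. 9 (2021), App. D, p. 133
  (the Hecke actions on `End(A_K)_ℚ`, (D.3)).
* [Lang1983AbelianVarieties] S. Lang, *Abelian Varieties*, Ch. VII §2 Prop. 4.
* [Milne1986AbelianVarieties] J. S. Milne, *Abelian varieties*, in Cornell–Silverman (1986), §17 (the Rosati involution).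
-/

noncomputable section

open CategoryTheory AlgebraicGeometry Complex
open scoped Matrix
open Literature.Geometry.Kaehler Literature.Geometry.Kaehler.ComplexTorus
open Literature.NumberTheory.Transcendental Literature.AlgebraicGeometry.HodgeTheory
open Literature.RingTheory.CentralSimple Literature.NumberTheory.Automorphic Literature.AlgebraicGeometry.ComplexMultiplication

namespace Literature.AlgebraicGeometry.Motives.AbelianVariety

variable {A : AbelianVariety ℂ} {ι : Type} [Fintype ι] [DecidableEq ι] {Φ : (ι → ℝ) ≃L[ℝ] (Fin A.dim → ℂ)}
  {φ : ComplexTorus Φ → ComplexPoints A.X} (hφ : IsAnalytification (Fin A.dim → ℂ) A.X A.dim φ)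
  (hadd : ∀ x y, φ (x + y) = φ x * φ y)

/-! ### §1 A level adjoint is the Rosati dual (Mumford §20 (3) + uniqueness of the level adjoint) -/

section LevelAdjoint

/-- `(u + u′) Q = u Q · u′ Q` on points (the group law of `A(ℂ)` is written multiplicatively). [folklore] -/
private theorem map_add_hom_apply' (u u' : End A) (Q : A.Points ℂ) :
    AlgPoints.map (u + u').hom.hom.hom Q = AlgPoints.map u.hom.hom.hom Q * AlgPoints.map u'.hom.hom.hom Q := by
  have h := congrArg (fun t => Q ≫ t) (hom_hom_hom_add (show A ⟶ A from u) u')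
  simp only at h
  rw [MonObj.comp_mul] at h
  exact h

/-- `0 Q = 1` on points. [folklore] -/
private theorem map_zero_hom_apply' (Q : A.Points ℂ) : AlgPoints.map (0 : End A).hom.hom.hom Q = 1 := by
  have h := map_add_hom_apply' (0 : End A) 0 Q
  rw [add_zero] at h
  exact mul_eq_left.mp h.symm

/-- `(n • u) Q = (u Q)^n` on points. [folklore] -/
private theorem map_nsmul_hom_apply' (n : ℕ) (u : End A) (Q : A.Points ℂ) :
    AlgPoints.map (n • u).hom.hom.hom Q = AlgPoints.map u.hom.hom.hom Q ^ n := by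
  induction n with
  | zero => rw [zero_nsmul, pow_zero, map_zero_hom_apply']
  | succ n ih => rw [succ_nsmul, map_add_hom_apply', ih, pow_succ]

/-- `((n : ℤ) • u) Q = (u Q)^n` on points. [folklore] -/
private theorem map_natCast_zsmul_hom_apply' (n : ℕ) (u : End A) (Q : A.Points ℂ) :
    AlgPoints.map ((n : ℤ) • u).hom.hom.hom Q = AlgPoints.map u.hom.hom.hom Q ^ n := by
  rw [natCast_zsmul, map_nsmul_hom_apply']

/-- The image of a torsion point under `(n : ℤ) • u` is the `n`-th power of its image under `u`, as torsion points. [folklore] -/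
private theorem torsionPoints_map_natCast_zsmul' {N : ℤ} (n : ℕ) (u : End A) (Q : A.torsionPoints ℂ N) :
    (⟨AlgPoints.map ((n : ℤ) • u).hom.hom.hom Q.1, map_mem_torsionPoints ((n : ℤ) • u) Q.2⟩ : A.torsionPoints ℂ N) =
      ⟨AlgPoints.map u.hom.hom.hom Q.1, map_mem_torsionPoints u Q.2⟩ ^ n :=
  Subtype.ext (map_natCast_zsmul_hom_apply' n u Q.1)

include hadd in
/-- The Rosati dual with a NATURAL denominator: `ρ_r(g) = n · rosati G ρ_r(x)` for some `n ∈ ℕ ∖ 0`, `g ∈ End(A)` (★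
`exists_rosatiDual`, changing the signs of `d` and `f′` if necessary). [cite: Lange2023AbelianVarietiesComplex, §2.4.1 Lemma 2.4.1 (p. 113)] -/
private theorem exists_rosatiDual_nat' {η : (Fin A.dim → ℂ) [⋀^Fin 2]→L[ℝ] ℝ} (hR : IsRiemannForm Φ η) {G : Matrix ι ι ℚ}
    (hG : G.map (Rat.cast : ℚ → ℝ) = latticeGram Φ η) (x : End A) :
    ∃ (n : ℕ) (g : End A), n ≠ 0 ∧
      ((endToEndAlgRat hφ hadd g : endAlgRat Φ) : Matrix ι ι ℚ) =
        (n : ℤ) • rosati G ((endToEndAlgRat hφ hadd x : endAlgRat Φ) : Matrix ι ι ℚ) := by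
  obtain ⟨d, f', hd, hff'⟩ := exists_rosatiDual hφ hadd hR hG x
  obtain ⟨n, rfl | rfl⟩ := Int.eq_nat_or_neg d
  · exact ⟨n, f', by exact_mod_cast hd, hff'⟩
  · refine ⟨n, -f', fun h => hd (by rw [h, Nat.cast_zero, neg_zero]), ?_⟩
    rw [map_neg, Subalgebra.coe_neg, hff', neg_smul, neg_neg]

include hφ hadd in
/-- **A level adjoint IS the Rosati dual** (Mumford §20 (3) «`e_n(f(x), ŷ) = e_n(x, f̂(ŷ))`» read backwards, with Lang VII §2
Prop. 4): for an AMPLE divisor `Θ` on the complex abelian variety `A` (with Appell–Humbert datum `p` of `[𝒪(Θ)^an]`, Riemann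
form `p.form`, rational Gram matrix `G`), if `x, x† ∈ End(A)` and `d ∈ ℕ` satisfy `ē_N^Θ((d·x) P, Q) = ē_N^Θ(P, x† Q)` for
every level `N` and all `P, Q ∈ A[N](ℂ)`, then `ρ_r(x†) = d · rosati G ρ_r(x)` — the Rosati dual `f′` of `x` (★
`exists_rosatiDual`, denominator `d′`) has the same level pairings as `x†` after clearing `d, d′`
(`ē(P, (d′·x†) Q) = ē(x P, Q)^{dd′} = ē(P, (d·f′) Q)`), so `d′·x† = d·f′` by ★ `eq_of_forall_weilPairingLevel_map_eq`.
[cite: MumfordAV1970, §20 (p. 186, property (3) of e_n) and §21] [cite: Lange2023AbelianVarietiesComplex, §2.4.1 Lemma 2.4.1 and Prop. 2.4.2 (a) (p. 113)]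
[cite: Lang1983AbelianVarieties, Ch. VII §2 Prop. 4] -/
theorem endToEndAlgRat_eq_smul_rosati_of_forall_weilPairingLevel (Θ : CartierDivisor A.X.left) (hΘ : Θ.IsAmple)
    (p : AHData Φ) (hp : AHData.toPic p = picClass (cartierDivisorLineBundle hφ Θ)) (hR : IsRiemannForm Φ p.form)
    {G : Matrix ι ι ℚ} (hG : G.map (Rat.cast : ℚ → ℝ) = latticeGram Φ p.form)
    {x xd : End A} {d : ℕ}
    (h : ∀ (N : ℕ) [IsDominant (Hom.toSchemeHom ((N : ℤ) • 𝟙 A))] (P Q : A.torsionPoints ℂ N),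
      A.weilPairingLevel Θ ⟨AlgPoints.map ((d : ℤ) • x).hom.hom.hom P.1, map_mem_torsionPoints ((d : ℤ) • x) P.2⟩ Q =
        A.weilPairingLevel Θ P ⟨AlgPoints.map xd.hom.hom.hom Q.1, map_mem_torsionPoints xd Q.2⟩) :
    ((endToEndAlgRat hφ hadd xd : endAlgRat Φ) : Matrix ι ι ℚ) =
      (d : ℤ) • rosati G ((endToEndAlgRat hφ hadd x : endAlgRat Φ) : Matrix ι ι ℚ) := by
  -- the Rosati dual `g` of `x`, with a natural denominator `n`
  obtain ⟨n, g, hn, hg⟩ := exists_rosatiDual_nat' hφ hadd hR hG x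
  -- `n · x† = d · g`: both have the level pairings `ē(x P, Q)^{d n}`
  have key : ((n : ℤ) • xd : End A) = (d : ℤ) • g := by
    refine eq_of_forall_weilPairingLevel_map_eq hφ hadd hΘ fun k _ P Q => ?_
    rw [torsionPoints_map_natCast_zsmul', torsionPoints_map_natCast_zsmul', weilPairingLevel_pow_right,
      weilPairingLevel_pow_right, ← h (2 ^ k) P Q, ← weilPairingLevel_map_rosatiDual hφ hadd Θ p hp hR hG hg P Q,
      torsionPoints_map_natCast_zsmul', torsionPoints_map_natCast_zsmul', weilPairingLevel_pow_left,
      weilPairingLevel_pow_left, ← pow_mul, ← pow_mul, mul_comm]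
  -- read `key` in the rational representation and cancel `n`
  have hmat := congrArg (fun u : End A => ((endToEndAlgRat hφ hadd u : endAlgRat Φ) : Matrix ι ι ℚ)) key
  simp only [map_zsmul, AddSubgroupClass.coe_zsmul] at hmat
  rw [hg, smul_comm, ← Int.cast_smul_eq_zsmul ℚ (n : ℤ), ← Int.cast_smul_eq_zsmul ℚ (n : ℤ) ((d : ℤ) • _)] at hmat
  exact smul_right_injective (Matrix ι ι ℚ) (by exact_mod_cast hn : ((n : ℤ) : ℚ) ≠ 0) hmat

end LevelAdjoint

/-! ### §2 A Rosati-stable `ℚ`-subalgebra of `End⁰(A)` carries a positive anti-involution (Lange Thm. 2.4.9; Mumford §21 Thm. 1) -/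

section Stable

include hadd in
/-- **A `ℚ`-subalgebra `H ⊆ End⁰(A)` stable under the Rosati involution of a Riemann form carries a POSITIVE ANTI-INVOLUTION**:
if for every `x ∈ H` the matrix `rosati G ρ(x)` is again some `ρ(y)`, `y ∈ H` (`ρ = endAlgebraEquivOfAnalytification`, the
rational representation of `End⁰(A)`), then `τ x := y` is a well-defined `ℚ`-linear anti-involution of `H` (`ρ` injective;
`rosati_add/smul/mul/rosati_rosati`) with `Tr_{H/ℚ}(L_{τ(x)·x}) > 0` for `x ≠ 0` (★ `leftMulTrace_pos_of_adjoint_repr` for the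
injective representation `H → M_ι(ℚ)` and the positive definite symmetric `ᵗJ G_ℝ`, ★ `posDef_transpose_jMatrix_mul_latticeGram`,
★ `rosati_eq_symmAdjoint`). [cite: Lange2023AbelianVarietiesComplex, §2.4.1 Lemma 2.4.1 and Theorem 2.4.9 (pp. 113–117)]
[cite: MumfordAV1970, §21 Thm. 1 (p. 192)] -/
theorem exists_isPositiveAntiInvolution_subalgebra_of_forall_exists_rosati {η : (Fin A.dim → ℂ) [⋀^Fin 2]→L[ℝ] ℝ}
    (hR : IsRiemannForm Φ η) {G : Matrix ι ι ℚ} (hG : G.map (Rat.cast : ℚ → ℝ) = latticeGram Φ η)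
    (H : Subalgebra ℚ A.endAlgebra)
    (hH : ∀ x ∈ H, ∃ y ∈ H, ((endAlgebraEquivOfAnalytification hφ hadd y : endAlgRat Φ) : Matrix ι ι ℚ) =
      rosati G ((endAlgebraEquivOfAnalytification hφ hadd x : endAlgRat Φ) : Matrix ι ι ℚ)) :
    ∃ τ : H →ₗ[ℚ] H, IsPositiveAntiInvolution H τ ∧
      ∀ x : H, ((endAlgebraEquivOfAnalytification hφ hadd (τ x : A.endAlgebra) : endAlgRat Φ) : Matrix ι ι ℚ) =
        rosati G ((endAlgebraEquivOfAnalytification hφ hadd (x : A.endAlgebra) : endAlgRat Φ) : Matrix ι ι ℚ) := by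
  classical
  set e := endAlgebraEquivOfAnalytification hφ hadd with he
  -- the injective representation `ψ : H → M_ι(ℚ)`
  let ψ : H →ₐ[ℚ] Matrix ι ι ℚ := ((endAlgRat Φ).val.comp e.toAlgHom).comp H.val
  have hψ : ∀ y : H, ψ y = ((e (y : A.endAlgebra) : endAlgRat Φ) : Matrix ι ι ℚ) := fun _ => rfl
  have hψmem : ∀ y : H, ψ y ∈ endAlgRat Φ := fun y => by rw [hψ]; exact (e (y : A.endAlgebra)).2
  have hψinj : Function.Injective ψ :=
    (Subtype.val_injective.comp e.injective).comp Subtype.val_injective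
  have hGu : IsUnit G.det := isUnit_det_of_map_ratCast hG (isUnit_det_latticeGram Φ hR.1 hR.2.2)
  have hGt : G.transpose = -G := transpose_eq_neg_of_map_ratCast Φ hG
  -- the candidate involution, pointwise
  choose τ₀ hτ₀mem hτ₀ using hH
  let τ₁ : H → H := fun y => ⟨τ₀ y y.2, hτ₀mem y y.2⟩
  have hτ₁ : ∀ y : H, ψ (τ₁ y) = rosati G (ψ y) := fun y => hτ₀ y y.2
  have hadd' : ∀ y z, τ₁ (y + z) = τ₁ y + τ₁ z := fun y z =>
    hψinj (by rw [hτ₁, map_add, rosati_add, map_add, hτ₁, hτ₁])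
  have hsmul' : ∀ (c : ℚ) y, τ₁ (c • y) = c • τ₁ y := fun c y =>
    hψinj (by rw [hτ₁, map_smul, rosati_smul, map_smul, hτ₁])
  let τ : H →ₗ[ℚ] H := { toFun := τ₁, map_add' := hadd', map_smul' := hsmul' }
  have hτ : ∀ y, ψ (τ y) = rosati G (ψ y) := hτ₁
  refine ⟨τ, ⟨⟨fun y z => hψinj ?_, fun y => hψinj ?_⟩, fun y hy => ?_⟩, fun y => hτ y⟩
  · rw [hτ, map_mul, rosati_mul hGu, map_mul, hτ, hτ]
  · rw [hτ, hτ, rosati_rosati hGu hGt]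
  · -- positivity, through the real symmetric form `S = ᵗJ G_ℝ`
    haveI : Module.Finite ℚ H := Module.Finite.of_injective ψ.toLinearMap hψinj
    rw [leftMulTrace_apply]
    have hS : ((jMatrix Φ).transpose * latticeGram Φ η).PosDef :=
      posDef_transpose_jMatrix_mul_latticeGram Φ hR.1 hR.2.2
    refine leftMulTrace_pos_of_adjoint_repr ψ hψinj hS τ (fun z => ?_) hy
    have hz : (ψ z).map (Rat.cast : ℚ → ℝ) * jMatrix Φ = jMatrix Φ * (ψ z).map (Rat.cast : ℚ → ℝ) :=
      (mem_endAlgRat_iff Φ _).1 (hψmem z)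
    rw [hτ, show (rosati G (ψ z)).map (Rat.cast : ℚ → ℝ) = (rosati G (ψ z)).map (Rat.castHom ℝ) from rfl,
      rosati_map (Rat.castHom ℝ) hGu, Rat.coe_castHom, hG, rosati_eq_symmAdjoint Φ _ hz]

include hadd in
/-- **Rosati stability is tested on generators**: if every generator `s ∈ S` of `H = ℚ[S] ⊆ End⁰(A)` has `rosati G ρ(s) = ρ(y)`
for some `y ∈ ℚ[S]`, then so does every element of `ℚ[S]` (the Rosati involution is a `ℚ`-linear ANTI-automorphism:
`rosati_one/add/smul/mul`; induction on `Algebra.adjoin`). [cite: Lange2023AbelianVarietiesComplex, §2.4.1 Lemma 2.4.1 (p. 113)] -/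
theorem forall_exists_rosati_adjoin_of_generators {η : (Fin A.dim → ℂ) [⋀^Fin 2]→L[ℝ] ℝ}
    (hR : IsRiemannForm Φ η) {G : Matrix ι ι ℚ} (hG : G.map (Rat.cast : ℚ → ℝ) = latticeGram Φ η)
    (S : Set A.endAlgebra)
    (hS : ∀ s ∈ S, ∃ y ∈ Algebra.adjoin ℚ S, ((endAlgebraEquivOfAnalytification hφ hadd y : endAlgRat Φ) : Matrix ι ι ℚ) =
      rosati G ((endAlgebraEquivOfAnalytification hφ hadd s : endAlgRat Φ) : Matrix ι ι ℚ)) :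
    ∀ x ∈ Algebra.adjoin ℚ S, ∃ y ∈ Algebra.adjoin ℚ S,
      ((endAlgebraEquivOfAnalytification hφ hadd y : endAlgRat Φ) : Matrix ι ι ℚ) =
        rosati G ((endAlgebraEquivOfAnalytification hφ hadd x : endAlgRat Φ) : Matrix ι ι ℚ) := by
  set e := endAlgebraEquivOfAnalytification hφ hadd with he
  have hGu : IsUnit G.det := isUnit_det_of_map_ratCast hG (isUnit_det_latticeGram Φ hR.1 hR.2.2)
  intro x hx
  induction hx using Algebra.adjoin_induction with
  | mem s hs => exact hS s hs
  | algebraMap r =>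
    refine ⟨algebraMap ℚ A.endAlgebra r, Subalgebra.algebraMap_mem _ r, ?_⟩
    rw [AlgEquiv.commutes, Subalgebra.coe_algebraMap, Algebra.algebraMap_eq_smul_one, rosati_smul, rosati_one hGu]
  | add x y _ _ ihx ihy =>
    obtain ⟨x', hx', ex⟩ := ihx
    obtain ⟨y', hy', ey⟩ := ihy
    refine ⟨x' + y', add_mem hx' hy', ?_⟩
    rw [map_add, Subalgebra.coe_add, ex, ey, map_add, Subalgebra.coe_add, rosati_add]
  | mul x y _ _ ihx ihy =>
    obtain ⟨x', hx', ex⟩ := ihx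
    obtain ⟨y', hy', ey⟩ := ihy
    refine ⟨y' * x', mul_mem hy' hx', ?_⟩
    rw [map_mul, Subalgebra.coe_mul, ex, ey, map_mul, Subalgebra.coe_mul, rosati_mul hGu]

end Stable

/-! ### §3 Level adjoints for the generators ⇒ a positive anti-involution on `ℚ[S]` (the `SocketRosH` producer core) -/

section Generators

include hφ hadd in
/-- **If every generator has a LEVEL ADJOINT inside `ℚ[S]`, then `ℚ[S] ⊆ End⁰(A)` carries a positive anti-involution which is the
Rosati involution of `Θ`** (Mumford §20 (3) and §21 Thm. 1; the use: the Hecke algebra acting on the Albanese variety of a Shimura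
curve, Liu 2021 App. D p. 133, whose generators have Hecke operators as level adjoints): for an AMPLE `Θ` (Appell–Humbert datum `p`, Riemann form, rational Gram matrix
`G`) and `S ⊆ End(A)` such that each `s ∈ S` has `d ∈ ℕ ∖ 0`, `s† ∈ End(A)` with `1 ⊗ s† ∈ ℚ[1 ⊗ S]` and
`ē_N^Θ((d·s) P, Q) = ē_N^Θ(P, s† Q)` for all `N, P, Q`, there is a `ℚ`-linear `τ` on `H := ℚ[1 ⊗ S]` which is a positive
anti-involution with `ρ(τ x) = rosati G ρ(x)` (§1 on the generators: `rosati G ρ(1 ⊗ s) = ρ(d⁻¹ ⊗ s†)`; then §2).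
[cite: MumfordAV1970, §20 (p. 186, property (3) of e_n) and §21 Thm. 1 (p. 192)]
[cite: Lange2023AbelianVarietiesComplex, §2.4.1 Lemma 2.4.1 and Theorem 2.4.9 (pp. 113–117)] [cite: Liu2021, App. D, p. 133 (the Hecke actions C_c^∞(K\G(𝔸^∞)/K, ℚ) → End(A_K)_ℚ, (D.3))] -/
theorem exists_isPositiveAntiInvolution_adjoin_of_levelAdjoint (Θ : CartierDivisor A.X.left) (hΘ : Θ.IsAmple)
    (p : AHData Φ) (hp : AHData.toPic p = picClass (cartierDivisorLineBundle hφ Θ)) (hR : IsRiemannForm Φ p.form)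
    {G : Matrix ι ι ℚ} (hG : G.map (Rat.cast : ℚ → ℝ) = latticeGram Φ p.form) (S : Set (End A))
    (hS : ∀ s ∈ S, ∃ (d : ℕ) (sd : End A), d ≠ 0 ∧ endAlgebra.of A sd ∈ Algebra.adjoin ℚ (endAlgebra.of A '' S) ∧
      ∀ (N : ℕ) [IsDominant (Hom.toSchemeHom ((N : ℤ) • 𝟙 A))] (P Q : A.torsionPoints ℂ N),
        A.weilPairingLevel Θ ⟨AlgPoints.map ((d : ℤ) • s).hom.hom.hom P.1, map_mem_torsionPoints ((d : ℤ) • s) P.2⟩ Q =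
          A.weilPairingLevel Θ P ⟨AlgPoints.map sd.hom.hom.hom Q.1, map_mem_torsionPoints sd Q.2⟩) :
    ∃ τ : ↥(Algebra.adjoin ℚ (endAlgebra.of A '' S)) →ₗ[ℚ] ↥(Algebra.adjoin ℚ (endAlgebra.of A '' S)),
      IsPositiveAntiInvolution ↥(Algebra.adjoin ℚ (endAlgebra.of A '' S)) τ ∧
      ∀ x : ↥(Algebra.adjoin ℚ (endAlgebra.of A '' S)),
        ((endAlgebraEquivOfAnalytification hφ hadd (τ x : A.endAlgebra) : endAlgRat Φ) : Matrix ι ι ℚ) =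
          rosati G ((endAlgebraEquivOfAnalytification hφ hadd (x : A.endAlgebra) : endAlgRat Φ) : Matrix ι ι ℚ) := by
  refine exists_isPositiveAntiInvolution_subalgebra_of_forall_exists_rosati hφ hadd hR hG _
    (forall_exists_rosati_adjoin_of_generators hφ hadd hR hG _ ?_)
  rintro _ ⟨s, hs, rfl⟩
  obtain ⟨d, sd, hd, hmem, hlev⟩ := hS s hs
  have hmat := endToEndAlgRat_eq_smul_rosati_of_forall_weilPairingLevel hφ hadd Θ hΘ p hp hR hG hlev
  refine ⟨(d : ℚ)⁻¹ • endAlgebra.of A sd, Subalgebra.smul_mem _ hmem _, ?_⟩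
  rw [map_smul, Subalgebra.coe_smul, endAlgebraEquivOfAnalytification_of, endAlgebraEquivOfAnalytification_of, hmat,
    ← Int.cast_smul_eq_zsmul ℚ (d : ℤ), smul_smul, Int.cast_natCast, inv_mul_cancel₀ (Nat.cast_ne_zero.2 hd), one_smul]

include hφ hadd in
/-- **On the generators the involution of §3 is the prescribed level adjoint**: any `ℚ`-linear `τ` on `ℚ[1 ⊗ S]` with
`ρ(τ x) = rosati G ρ(x)` satisfies `τ(1 ⊗ s) = d⁻¹ · (1 ⊗ s†)` whenever `ē_N^Θ((d·s) P, Q) = ē_N^Θ(P, s† Q)` for all `N, P, Q`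
(§1 and injectivity of `ρ`). [cite: MumfordAV1970, §20 (p. 186, property (3) of e_n)] [cite: Lange2023AbelianVarietiesComplex, §2.4.1 Prop. 2.4.2 (a) (p. 113)] -/
theorem coe_apply_eq_smul_of_levelAdjoint (Θ : CartierDivisor A.X.left) (hΘ : Θ.IsAmple)
    (p : AHData Φ) (hp : AHData.toPic p = picClass (cartierDivisorLineBundle hφ Θ)) (hR : IsRiemannForm Φ p.form)
    {G : Matrix ι ι ℚ} (hG : G.map (Rat.cast : ℚ → ℝ) = latticeGram Φ p.form) {H : Subalgebra ℚ A.endAlgebra}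
    (τ : H →ₗ[ℚ] H)
    (hτ : ∀ x : H, ((endAlgebraEquivOfAnalytification hφ hadd (τ x : A.endAlgebra) : endAlgRat Φ) : Matrix ι ι ℚ) =
      rosati G ((endAlgebraEquivOfAnalytification hφ hadd (x : A.endAlgebra) : endAlgRat Φ) : Matrix ι ι ℚ))
    {s sd : End A} (hs : endAlgebra.of A s ∈ H) {d : ℕ} (hd : d ≠ 0)
    (h : ∀ (N : ℕ) [IsDominant (Hom.toSchemeHom ((N : ℤ) • 𝟙 A))] (P Q : A.torsionPoints ℂ N),
      A.weilPairingLevel Θ ⟨AlgPoints.map ((d : ℤ) • s).hom.hom.hom P.1, map_mem_torsionPoints ((d : ℤ) • s) P.2⟩ Q =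
        A.weilPairingLevel Θ P ⟨AlgPoints.map sd.hom.hom.hom Q.1, map_mem_torsionPoints sd Q.2⟩) :
    (τ ⟨endAlgebra.of A s, hs⟩ : A.endAlgebra) = (d : ℚ)⁻¹ • endAlgebra.of A sd := by
  have hmat := endToEndAlgRat_eq_smul_rosati_of_forall_weilPairingLevel hφ hadd Θ hΘ p hp hR hG h
  apply (endAlgebraEquivOfAnalytification hφ hadd).injective
  apply Subtype.ext
  rw [hτ, map_smul, Subalgebra.coe_smul, endAlgebraEquivOfAnalytification_of, endAlgebraEquivOfAnalytification_of, hmat,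
    ← Int.cast_smul_eq_zsmul ℚ (d : ℤ), smul_smul, Int.cast_natCast, inv_mul_cancel₀ (Nat.cast_ne_zero.2 hd), one_smul]

end Generators

end Literature.AlgebraicGeometry.Motives.AbelianVariety

end
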